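import Literature.AlgebraicGeometry.HodgeTheory.SymmetricA3KernelLineJets
import Literature.AlgebraicGeometry.HodgeTheory.SymmetricA3EquivariantSlice
import Literature.AlgebraicGeometry.HodgeTheory.SymmetricA3AxisMember
import Literature.Analysis.Complex.OsgoodProofs
import HarnessLib

/-!
# The reduced function of the symmetric `A₃` unfolding: holomorphic, even, of order four in `u`, vanishing on
# the axis, with `∂_β r(0) = g₀(e_j)` and `∂ᵤ²r ≠ 0` along the axis (the inputs of the even Weierstrass route)

Family `hodge`, layer `Literature/AlgebraicGeometry/HodgeTheory`, companion of `SymmetricA3ReducedChart` (the reduced chart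
`xs`, quotient `s` with `∂ₖF = u·s`, gradient identity `dr = g₂(xs) dα + g₀(xs) dβ + u s du`),
`SymmetricA3KernelLineJets` (jets along the kernel lines `(α, β, u) = (ct, 0, t)`: `σ_c(0) = 0`, `σ_c'(0) = cκ`,
`ord σ₀ = 2`) and the chart-free files `Geometry/ComplexAnalytic/EvenQuarticWeierstrass{Bifurcation,Branches,Nodes}`.
Written by the prover seat `hodge-nonav-19716-p2` (g8, cell `hodge-nonav`) for programme B2-BIF (bifurcation half
`IsSymmetricA3Bifurcation` of the binder hB2 `picardLefschetz_symmetricA3` of crux K1-B of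
`Summits/HodgeConjecture/HodgeConjecture/Theses/SignSymmetricPowers.lean`, stmt-HodgeConjecture-19716).

For the REDUCED FUNCTION `r(p) = F_{αβ}(xs(p))`, `p = ((α, β), u)`, of a slice chart with the properties delivered by
`IsSymmetricA3Datum.exists_reducedChart` (taken as hypotheses conjunct by conjunct), this file proves the five inputs of
the even Weierstrass route (AGZV II §5.2: the `ℤ₂`-invariant function on the double cover is `u⁴ + λ₁u² + λ₂` up to a
unit):

* `reduced_differentiableOn`, `reduced_even` — `r` is holomorphic on `D` and even in `u`;
* `reduced_hasDerivAt_u`, `reduced_iteratedDeriv_two` — `∂ᵤr = ∂ₖF_{αβ}∘xs = u·s` and `∂ᵤ²r(μ, u₀)` is the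
  `u`-derivative of `∂ₖF_{αβ}∘xs`;
* `reduced_analyticOrderAt_eq_four` — `ord_{u=0} r(0, ·) = 4` (from `ord σ₀ = 2`);
* `reduced_eventually_axis` — `xs((α,0),0) = e_j` and `r((α,0),0) = 0` for `α` near `0` (uniqueness of the chart);
* `reduced_hasFDerivAt_zero` — `μ ↦ r(μ, 0)` has derivative `g₂(e_j) dα + g₀(e_j) dβ` at `0`, with
  `β`-component `g₀(e_j) ≠ 0`;
* `reduced_eventually_second_deriv_ne_zero` — `∂ᵤ²r((α,0),0) = s((α,0),0) ≠ 0` for `α ≠ 0` near `0`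
  (`∂_α s(0) = ∂ₖ∂ₖg₂(e_j) ≠ 0`, `∂ᵤ s(0) = 0` from the kernel-line jets).

## References
* [ArnoldGuseinzadeVarchenko2012] AGZV II, Part I §5.2 (pp. 129–133 of the held text).
* [VoisinHodgeII2003] Voisin II, §2.1.1 Lemma 2.7.
-/

noncomputable section

open MvPolynomial Metric Set Filter
open scoped Topology
open Literature.AlgebraicGeometry.Motives

namespace Literature.AlgebraicGeometry.HodgeTheory

section HodgeTheory

variable {n d : ℕ} {f₁ g₀ g₂ : MvPolynomial (Fin (n + 2)) ℂ} {j k : Fin (n + 2)} {a : Fin (n + 2) → ℂˣ}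
  {D : Set ((ℂ × ℂ) × ℂ)} {xs : (ℂ × ℂ) × ℂ → (Fin (n + 2) → ℂ)} {s : (ℂ × ℂ) × ℂ → ℂ}

namespace IsSymmetricA3Datum

/-- **The reduced function is holomorphic** (from the gradient identity of the reduced chart).
[cite: ArnoldGuseinzadeVarchenko2012, Part I §5.2] -/
theorem reduced_differentiableOn
    (hgrad : ∀ p ∈ D, HasFDerivAt (fun q : (ℂ × ℂ) × ℂ => eval (xs q) (f₁ + q.1.1 • g₂ + q.1.2 • g₀))
      (eval (xs p) g₂ • (ContinuousLinearMap.fst ℂ ℂ ℂ).comp (ContinuousLinearMap.fst ℂ (ℂ × ℂ) ℂ) +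
        eval (xs p) g₀ • (ContinuousLinearMap.snd ℂ ℂ ℂ).comp (ContinuousLinearMap.fst ℂ (ℂ × ℂ) ℂ) +
        (p.2 * s p) • ContinuousLinearMap.snd ℂ (ℂ × ℂ) ℂ) p) :
    DifferentiableOn ℂ (fun q : (ℂ × ℂ) × ℂ => eval (xs q) (f₁ + q.1.1 • g₂ + q.1.2 • g₀)) D :=
  fun p hp => (hgrad p hp).differentiableAt.differentiableWithinAt

/-- **The reduced function is even in `u`** (the chart is equivariant and every member is `a`-symmetric).
[cite: ArnoldGuseinzadeVarchenko2012, Part I §5.2 (the `ℤ₂`-invariant function `f̂`)] -/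
theorem reduced_even (hg₀ : g₀.IsHomogeneous d) (hf₁ : f₁.IsHomogeneous d) (hg₂ : g₂.IsHomogeneous d)
    (hD : IsSymmetricA3Datum f₁ g₀ g₂ j k a)
    (hrefl : ∀ p ∈ D, (p.1, -p.2) ∈ D ∧ xs (p.1, -p.2) = (a j : ℂ) • (a • xs p)) :
    ∀ p ∈ D, (p.1, -p.2) ∈ D ∧
      eval (xs (p.1, -p.2)) (f₁ + (p.1, -p.2).1.1 • g₂ + (p.1, -p.2).1.2 • g₀) =
        eval (xs p) (f₁ + p.1.1 • g₂ + p.1.2 • g₀) := by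
  intro p hp
  obtain ⟨hmem, hxs⟩ := hrefl p hp
  refine ⟨hmem, ?_⟩
  have hF : (f₁ + p.1.1 • g₂ + p.1.2 • g₀).IsHomogeneous d := by
    rw [MvPolynomial.smul_eq_C_mul, MvPolynomial.smul_eq_C_mul]
    exact (hf₁.add (hg₂.C_mul _)).add (hg₀.C_mul _)
  rw [hxs]
  exact hD.eval_reflect hg₀ hF (hD.mem_diagonalStabilizer_member _ _) _

/-- **`∂ᵤ r = ∂ₖF∘xs = u·s`** along the line `μ = const` (the `du`-component of the gradient identity).
[cite: ArnoldGuseinzadeVarchenko2012, Part I §5.2] -/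
theorem reduced_hasDerivAt_u
    (hgrad : ∀ p ∈ D, HasFDerivAt (fun q : (ℂ × ℂ) × ℂ => eval (xs q) (f₁ + q.1.1 • g₂ + q.1.2 • g₀))
      (eval (xs p) g₂ • (ContinuousLinearMap.fst ℂ ℂ ℂ).comp (ContinuousLinearMap.fst ℂ (ℂ × ℂ) ℂ) +
        eval (xs p) g₀ • (ContinuousLinearMap.snd ℂ ℂ ℂ).comp (ContinuousLinearMap.fst ℂ (ℂ × ℂ) ℂ) +
        (p.2 * s p) • ContinuousLinearMap.snd ℂ (ℂ × ℂ) ℂ) p)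
    {μ : ℂ × ℂ} {u : ℂ} (hp : (μ, u) ∈ D) :
    HasDerivAt (fun v => eval (xs (μ, v)) (f₁ + μ.1 • g₂ + μ.2 • g₀)) (u * s (μ, u)) u := by
  have hι : HasDerivAt (fun v : ℂ => ((μ, v) : (ℂ × ℂ) × ℂ)) ((0 : ℂ × ℂ), (1 : ℂ)) u :=
    (hasDerivAt_const u μ).prodMk (hasDerivAt_id u)
  have h := (hgrad (μ, u) hp).comp_hasDerivAt u hι
  have hval : (eval (xs (μ, u)) g₂ • (ContinuousLinearMap.fst ℂ ℂ ℂ).comp (ContinuousLinearMap.fst ℂ (ℂ × ℂ) ℂ) +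
      eval (xs (μ, u)) g₀ • (ContinuousLinearMap.snd ℂ ℂ ℂ).comp (ContinuousLinearMap.fst ℂ (ℂ × ℂ) ℂ) +
      ((μ, u).2 * s (μ, u)) • ContinuousLinearMap.snd ℂ (ℂ × ℂ) ℂ) ((0 : ℂ × ℂ), (1 : ℂ)) = u * s (μ, u) := by
    simp
  rw [hval] at h
  exact h

/-- Consequently `∂ᵤr(μ, ·) = ∂ₖF_μ∘xs(μ, ·)` near every `u₀` with `(μ, u₀) ∈ D`, and **the second `u`-derivative of
the reduced function is the `u`-derivative of `∂ₖF_μ∘xs`**. [cite: ArnoldGuseinzadeVarchenko2012, Part I §5.2] -/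
theorem reduced_iteratedDeriv_two (hDo : IsOpen D)
    (hks : ∀ p ∈ D, eval (xs p) (pderiv k (f₁ + p.1.1 • g₂ + p.1.2 • g₀)) = p.2 * s p)
    (hgrad : ∀ p ∈ D, HasFDerivAt (fun q : (ℂ × ℂ) × ℂ => eval (xs q) (f₁ + q.1.1 • g₂ + q.1.2 • g₀))
      (eval (xs p) g₂ • (ContinuousLinearMap.fst ℂ ℂ ℂ).comp (ContinuousLinearMap.fst ℂ (ℂ × ℂ) ℂ) +
        eval (xs p) g₀ • (ContinuousLinearMap.snd ℂ ℂ ℂ).comp (ContinuousLinearMap.fst ℂ (ℂ × ℂ) ℂ) +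
        (p.2 * s p) • ContinuousLinearMap.snd ℂ (ℂ × ℂ) ℂ) p)
    {μ : ℂ × ℂ} {u₀ : ℂ} (hp : (μ, u₀) ∈ D) :
    iteratedDeriv 2 (fun v => eval (xs (μ, v)) (f₁ + μ.1 • g₂ + μ.2 • g₀)) u₀ =
      deriv (fun v => eval (xs (μ, v)) (pderiv k (f₁ + μ.1 • g₂ + μ.2 • g₀))) u₀ := by
  have hnhds : ∀ᶠ v in 𝓝 u₀, ((μ, v) : (ℂ × ℂ) × ℂ) ∈ D := by
    have hc : Continuous fun v : ℂ => ((μ, v) : (ℂ × ℂ) × ℂ) := by fun_prop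
    exact hc.continuousAt.eventually_mem (hDo.mem_nhds hp)
  have hev : deriv (fun v => eval (xs (μ, v)) (f₁ + μ.1 • g₂ + μ.2 • g₀)) =ᶠ[𝓝 u₀]
      fun v => eval (xs (μ, v)) (pderiv k (f₁ + μ.1 • g₂ + μ.2 • g₀)) := by
    filter_upwards [hnhds] with v hv
    rw [(reduced_hasDerivAt_u hgrad hv).deriv, hks (μ, v) hv]
  rw [iteratedDeriv_eq_iterate]
  show deriv (deriv fun v => eval (xs (μ, v)) (f₁ + μ.1 • g₂ + μ.2 • g₀)) u₀ = _
  rw [hev.deriv_eq]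

/-- **On the axis `β = 0` the chart point over `u = 0` is `e_j` and the reduced function vanishes** for `α` near `0`
(uniqueness clause of the reduced chart, `e_j` solving the slice system of `f₁ + α g₂`).
[cite: ArnoldGuseinzadeVarchenko2012, Part I §5.2] -/
theorem reduced_eventually_axis (hf₁ : f₁.IsHomogeneous d) (hD : IsSymmetricA3Datum f₁ g₀ g₂ j k a)
    (huniq : ∃ ρ : ℝ, 0 < ρ ∧ ∀ (μ : ℂ × ℂ) (x : Fin (n + 2) → ℂ), ‖μ‖ < ρ → ‖x - Pi.single j 1‖ < ρ → x j = 1 →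
      (∀ i, i ≠ j → i ≠ k → eval x (pderiv i (f₁ + μ.1 • g₂ + μ.2 • g₀)) = 0) →
      (μ, x k) ∈ D ∧ xs (μ, x k) = x) :
    ∀ᶠ α in 𝓝 (0 : ℂ), (((α, 0) : ℂ × ℂ), (0 : ℂ)) ∈ D ∧ xs ((α, 0), 0) = Pi.single j 1 ∧
      eval (xs ((α, 0), 0)) (f₁ + α • g₂ + (0 : ℂ) • g₀) = 0 := by
  have hjk : j ≠ k := hD.1
  obtain ⟨ρ, hρ, hU⟩ := huniq
  filter_upwards [Metric.ball_mem_nhds (0 : ℂ) hρ] with α hα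
  have hμ : ‖((α, 0) : ℂ × ℂ)‖ < ρ := by
    rw [mem_ball_zero_iff] at hα
    simp [Prod.norm_def, hα]
  have h := hU (α, 0) (Pi.single j 1) hμ (by simp [hρ]) (by simp)
    (fun i _ _ => hD.eval_pderiv_axisMember α i)
  simp only [Pi.single_eq_of_ne hjk.symm] at h
  refine ⟨h.1, h.2, ?_⟩
  rw [h.2]
  exact hD.eval_axisMember hf₁ α

/-- **The derivative of `μ ↦ r(μ, 0)` at `0` is `g₂(e_j) dα + g₀(e_j) dβ`; its `β`-component is `g₀(e_j) ≠ 0`.**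
[cite: ArnoldGuseinzadeVarchenko2012, Part I §5.2] -/
theorem reduced_hasFDerivAt_zero (hD : IsSymmetricA3Datum f₁ g₀ g₂ j k a) (h0D : (0 : (ℂ × ℂ) × ℂ) ∈ D)
    (hxs0 : xs 0 = Pi.single j 1)
    (hgrad : ∀ p ∈ D, HasFDerivAt (fun q : (ℂ × ℂ) × ℂ => eval (xs q) (f₁ + q.1.1 • g₂ + q.1.2 • g₀))
      (eval (xs p) g₂ • (ContinuousLinearMap.fst ℂ ℂ ℂ).comp (ContinuousLinearMap.fst ℂ (ℂ × ℂ) ℂ) +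
        eval (xs p) g₀ • (ContinuousLinearMap.snd ℂ ℂ ℂ).comp (ContinuousLinearMap.fst ℂ (ℂ × ℂ) ℂ) +
        (p.2 * s p) • ContinuousLinearMap.snd ℂ (ℂ × ℂ) ℂ) p) :
    ∃ L : ℂ × ℂ →L[ℂ] ℂ,
      HasFDerivAt (fun μ : ℂ × ℂ => eval (xs (μ, 0)) (f₁ + μ.1 • g₂ + μ.2 • g₀)) L 0 ∧ L (0, 1) ≠ 0 := by
  set L : ℂ × ℂ →L[ℂ] ℂ :=
    eval (Pi.single j (1 : ℂ)) g₂ • ContinuousLinearMap.fst ℂ ℂ ℂ + eval (Pi.single j (1 : ℂ)) g₀ • ContinuousLinearMap.snd ℂ ℂ ℂ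
    with hL
  refine ⟨L, ?_, ?_⟩
  · have hι : HasFDerivAt (fun μ : ℂ × ℂ => ((μ, 0) : (ℂ × ℂ) × ℂ)) (ContinuousLinearMap.inl ℂ (ℂ × ℂ) ℂ) 0 :=
      (ContinuousLinearMap.inl ℂ (ℂ × ℂ) ℂ).hasFDerivAt
    have h := (hgrad 0 h0D).comp (0 : ℂ × ℂ) hι
    have hLeq : (eval (xs 0) g₂ • (ContinuousLinearMap.fst ℂ ℂ ℂ).comp (ContinuousLinearMap.fst ℂ (ℂ × ℂ) ℂ) +
        eval (xs 0) g₀ • (ContinuousLinearMap.snd ℂ ℂ ℂ).comp (ContinuousLinearMap.fst ℂ (ℂ × ℂ) ℂ) +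
        ((0 : (ℂ × ℂ) × ℂ).2 * s 0) • ContinuousLinearMap.snd ℂ (ℂ × ℂ) ℂ).comp
          (ContinuousLinearMap.inl ℂ (ℂ × ℂ) ℂ) = L := by
      refine ContinuousLinearMap.ext fun v => ?_
      obtain ⟨x, y⟩ := v
      simp [hL, hxs0]
    rw [hLeq] at h
    exact h
  · simp [hL]
    exact hD.eval_g₀_ne

/-! ### The kernel-line data of the reduced chart -/

/-- The point `((c·0, 0), 0)` is the origin. [folklore] -/
private theorem lineC_zero (c : ℂ) : (((c * 0, (0 : ℂ)), (0 : ℂ)) : (ℂ × ℂ) × ℂ) = 0 :=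
  Prod.ext (Prod.ext (mul_zero c) rfl) rfl

/-- The line `t ↦ ((c t, 0), t)` through the reduced chart satisfies the hypotheses of the kernel-line jet lemmas:
`y_c(t) = xs((ct, 0), t)` is analytic at `0` with `y_c(0) = e_j`, `y_c(t)_j = 1`, `y_c(t)_k = t`, the slice equations of
`f₁ + (ct) g₂`, and `∂ₖ(f₁ + (ct) g₂)(y_c(t)) = t · s((ct, 0), t)`. [cite: ArnoldGuseinzadeVarchenko2012, Part I §5.2] -/
theorem kernelLine_of_reducedChart (hDo : IsOpen D) (h0D : (0 : (ℂ × ℂ) × ℂ) ∈ D) (hxsA : AnalyticOnNhd ℂ xs D)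
    (hxs0 : xs 0 = Pi.single j 1)
    (hchart : ∀ p ∈ D, xs p j = 1 ∧ xs p k = p.2 ∧
      ∀ i, i ≠ j → i ≠ k → eval (xs p) (pderiv i (f₁ + p.1.1 • g₂ + p.1.2 • g₀)) = 0)
    (hks : ∀ p ∈ D, eval (xs p) (pderiv k (f₁ + p.1.1 • g₂ + p.1.2 • g₀)) = p.2 * s p) (c : ℂ) :
    AnalyticAt ℂ (fun t : ℂ => xs ((c * t, 0), t)) 0 ∧ (fun t : ℂ => xs ((c * t, 0), t)) 0 = Pi.single j 1 ∧
      (∀ᶠ t in 𝓝 (0 : ℂ), xs ((c * t, 0), t) j = 1 ∧ xs ((c * t, 0), t) k = t ∧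
        ∀ i, i ≠ j → i ≠ k → eval (xs ((c * t, 0), t)) (pderiv i (f₁ + (c * t) • g₂)) = 0) ∧
      (∀ᶠ t in 𝓝 (0 : ℂ), eval (xs ((c * t, 0), t)) (pderiv k (f₁ + (c * t) • g₂)) = t * s ((c * t, 0), t)) := by
  have hι : Continuous fun t : ℂ => (((c * t, 0), t) : (ℂ × ℂ) × ℂ) := by fun_prop
  have hιa : AnalyticAt ℂ (fun t : ℂ => (((c * t, 0), t) : (ℂ × ℂ) × ℂ)) 0 :=
    ((analyticAt_const.mul analyticAt_id).prod analyticAt_const).prod analyticAt_id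
  have hnhds : ∀ᶠ t in 𝓝 (0 : ℂ), (((c * t, 0), t) : (ℂ × ℂ) × ℂ) ∈ D :=
    hι.continuousAt.eventually_mem (by rw [lineC_zero]; exact hDo.mem_nhds h0D)
  refine ⟨(hxsA 0 h0D).comp_of_eq hιa (lineC_zero c), ?_, ?_, ?_⟩
  · show xs ((c * 0, 0), 0) = Pi.single j 1
    rw [lineC_zero, hxs0]
  · filter_upwards [hnhds] with t ht
    obtain ⟨hj, hk, heqs⟩ := hchart _ ht
    refine ⟨hj, hk, fun i hij hik => ?_⟩
    have h := heqs i hij hik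
    simpa using h
  · filter_upwards [hnhds] with t ht
    have h := hks _ ht
    simpa using h

/-- A function holomorphic on `D` is analytic at `0` along the lines `t ↦ ((c t, 0), t)`, `α ↦ ((α, 0), 0)` and
`u ↦ (0, u)`. [folklore] -/
private theorem analyticAt_comp_lines {g : (ℂ × ℂ) × ℂ → ℂ} (hDo : IsOpen D) (h0D : (0 : (ℂ × ℂ) × ℂ) ∈ D)
    (hg : DifferentiableOn ℂ g D) (c : ℂ) :
    AnalyticAt ℂ (fun t : ℂ => g ((c * t, 0), t)) 0 ∧ AnalyticAt ℂ (fun α : ℂ => g ((α, 0), 0)) 0 ∧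
      AnalyticAt ℂ (fun u : ℂ => g ((0 : ℂ × ℂ), u)) 0 := by
  have hga : AnalyticAt ℂ g 0 := Literature.Analysis.Complex.SCV.analyticAt_of_differentiableOn hg hDo h0D
  refine ⟨?_, ?_, ?_⟩
  · have hιa : AnalyticAt ℂ (fun t : ℂ => (((c * t, 0), t) : (ℂ × ℂ) × ℂ)) 0 :=
      ((analyticAt_const.mul analyticAt_id).prod analyticAt_const).prod analyticAt_id
    exact hga.comp_of_eq hιa (lineC_zero c)
  · have hιa : AnalyticAt ℂ (fun α : ℂ => (((α, 0), 0) : (ℂ × ℂ) × ℂ)) 0 :=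
      (analyticAt_id.prod analyticAt_const).prod analyticAt_const
    exact hga.comp_of_eq hιa rfl
  · have hιa : AnalyticAt ℂ (fun u : ℂ => (((0 : ℂ × ℂ), u) : (ℂ × ℂ) × ℂ)) 0 :=
      analyticAt_const.prod analyticAt_id
    exact hga.comp_of_eq hιa rfl

/-- **The reduced function has order exactly four in `u` at the origin** (`∂ᵤr(0, u) = u·σ₀(u)` with `ord σ₀ = 2`,
`r(0) = 0`). [cite: ArnoldGuseinzadeVarchenko2012, Part I §5.2 (the `A₃` germ `u⁴ + …`)] -/
theorem reduced_analyticOrderAt_eq_four (hf₁ : f₁.IsHomogeneous d) (hD : IsSymmetricA3Datum f₁ g₀ g₂ j k a)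
    (hDo : IsOpen D) (h0D : (0 : (ℂ × ℂ) × ℂ) ∈ D) (hxsA : AnalyticOnNhd ℂ xs D) (hsd : DifferentiableOn ℂ s D)
    (hxs0 : xs 0 = Pi.single j 1)
    (hchart : ∀ p ∈ D, xs p j = 1 ∧ xs p k = p.2 ∧
      ∀ i, i ≠ j → i ≠ k → eval (xs p) (pderiv i (f₁ + p.1.1 • g₂ + p.1.2 • g₀)) = 0)
    (hks : ∀ p ∈ D, eval (xs p) (pderiv k (f₁ + p.1.1 • g₂ + p.1.2 • g₀)) = p.2 * s p)
    (hgrad : ∀ p ∈ D, HasFDerivAt (fun q : (ℂ × ℂ) × ℂ => eval (xs q) (f₁ + q.1.1 • g₂ + q.1.2 • g₀))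
      (eval (xs p) g₂ • (ContinuousLinearMap.fst ℂ ℂ ℂ).comp (ContinuousLinearMap.fst ℂ (ℂ × ℂ) ℂ) +
        eval (xs p) g₀ • (ContinuousLinearMap.snd ℂ ℂ ℂ).comp (ContinuousLinearMap.fst ℂ (ℂ × ℂ) ℂ) +
        (p.2 * s p) • ContinuousLinearMap.snd ℂ (ℂ × ℂ) ℂ) p)
    {r : (ℂ × ℂ) × ℂ → ℂ} (hr : ∀ q, r q = eval (xs q) (f₁ + q.1.1 • g₂ + q.1.2 • g₀)) :
    analyticOrderAt (fun u => r (0, u)) 0 = 4 := by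
  -- the kernel line `c = 0`
  obtain ⟨hy, hy0, hyc, hlam⟩ := kernelLine_of_reducedChart hDo h0D hxsA hxs0 hchart hks 0
  have hyc' : ∀ᶠ t in 𝓝 (0 : ℂ), xs ((0 * t, 0), t) j = 1 ∧ xs ((0 * t, 0), t) k = t ∧
      ∀ i, i ≠ j → i ≠ k → eval (xs ((0 * t, 0), t)) (pderiv i f₁) = 0 :=
    hyc.mono fun t ht => ⟨ht.1, ht.2.1, fun i hij hik => by simpa using ht.2.2 i hij hik⟩
  have hlam' : ∀ᶠ t in 𝓝 (0 : ℂ), eval (xs ((0 * t, 0), t)) (pderiv k f₁) = t * s ((0 * t, 0), t) :=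
    hlam.mono fun t ht => by simpa using ht
  have hσ : AnalyticAt ℂ (fun t : ℂ => s ((0 * t, 0), t)) 0 := (analyticAt_comp_lines hDo h0D hsd 0).1
  obtain ⟨-, -, -, hord2⟩ := hD.kernelLine_reduced_order_two hf₁ hy hy0 hyc' hσ hlam'
  -- the base slice `R₀(u) = r(0, u)` and its derivative `u · σ₀(u)`
  have hrd : DifferentiableOn ℂ r D := (reduced_differentiableOn hgrad).congr fun q _ => hr q
  have hR₀ : AnalyticAt ℂ (fun u => r (0, u)) 0 := (analyticAt_comp_lines hDo h0D hrd 0).2.2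
  have hnhds : ∀ᶠ u in 𝓝 (0 : ℂ), (((0 : ℂ × ℂ), u) : (ℂ × ℂ) × ℂ) ∈ D := by
    have hc : Continuous fun u : ℂ => (((0 : ℂ × ℂ), u) : (ℂ × ℂ) × ℂ) := by fun_prop
    exact hc.continuousAt.eventually_mem (hDo.mem_nhds h0D)
  -- `σ₀` in the two spellings `s((0·u, 0), u)` and `s(0, u)`
  have hσfun : (fun u : ℂ => s ((0 * u, 0), u)) = fun u => s ((0 : ℂ × ℂ), u) :=
    funext fun u => by rw [show (((0 : ℂ) * u, (0 : ℂ)) : ℂ × ℂ) = 0 from Prod.ext (zero_mul u) rfl]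
  have hord2' : analyticOrderAt (fun u : ℂ => s ((0 : ℂ × ℂ), u)) 0 = 2 := by
    rw [hσfun] at hord2; exact hord2
  have hσ' : AnalyticAt ℂ (fun u : ℂ => s ((0 : ℂ × ℂ), u)) 0 := by rw [hσfun] at hσ; exact hσ
  have hderiv : deriv (fun u => r (0, u)) =ᶠ[𝓝 0] fun u => u * s ((0 : ℂ × ℂ), u) := by
    filter_upwards [hnhds] with u hu
    have h := reduced_hasDerivAt_u hgrad hu
    have hfun : (fun v => r (0, v)) =
        fun v => eval (xs ((0 : ℂ × ℂ), v)) (f₁ + (0 : ℂ × ℂ).1 • g₂ + (0 : ℂ × ℂ).2 • g₀) :=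
      funext fun v => hr _
    rw [hfun]
    exact h.deriv
  have hord3 : analyticOrderAt (deriv fun u => r (0, u)) 0 = 3 := by
    rw [analyticOrderAt_congr hderiv]
    have h := analyticOrderAt_mul (analyticAt_id : AnalyticAt ℂ id (0 : ℂ)) hσ'
    have hfun : (id * fun u : ℂ => s ((0 : ℂ × ℂ), u)) = fun u => u * s ((0 : ℂ × ℂ), u) := rfl
    rw [hfun] at h
    rw [h, analyticOrderAt_id, hord2']
    rfl
  have hr0 : r (0, 0) = 0 := by
    rw [hr]
    simp only [Prod.fst_zero, Prod.snd_zero, zero_smul, add_zero]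
    rw [show (((0 : ℂ × ℂ), (0 : ℂ)) : (ℂ × ℂ) × ℂ) = 0 from rfl, hxs0]
    exact hD.eval_f₁ hf₁
  have h := hR₀.analyticOrderAt_deriv_add_one
  have hfun : (fun u => r (0, u) - r (0, 0)) = fun u => r (0, u) := by funext u; rw [hr0, sub_zero]
  rw [hfun, hord3] at h
  rw [← h]
  rfl

/-- **The second `u`-derivative of the reduced function on the axis is `s((α, 0), 0)`.**
[cite: ArnoldGuseinzadeVarchenko2012, Part I §5.2] -/
theorem reduced_iteratedDeriv_two_axis (hDo : IsOpen D) (hsd : DifferentiableOn ℂ s D)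
    (hks : ∀ p ∈ D, eval (xs p) (pderiv k (f₁ + p.1.1 • g₂ + p.1.2 • g₀)) = p.2 * s p)
    (hgrad : ∀ p ∈ D, HasFDerivAt (fun q : (ℂ × ℂ) × ℂ => eval (xs q) (f₁ + q.1.1 • g₂ + q.1.2 • g₀))
      (eval (xs p) g₂ • (ContinuousLinearMap.fst ℂ ℂ ℂ).comp (ContinuousLinearMap.fst ℂ (ℂ × ℂ) ℂ) +
        eval (xs p) g₀ • (ContinuousLinearMap.snd ℂ ℂ ℂ).comp (ContinuousLinearMap.fst ℂ (ℂ × ℂ) ℂ) +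
        (p.2 * s p) • ContinuousLinearMap.snd ℂ (ℂ × ℂ) ℂ) p)
    {μ : ℂ × ℂ} (hp : (μ, (0 : ℂ)) ∈ D) :
    iteratedDeriv 2 (fun v => eval (xs (μ, v)) (f₁ + μ.1 • g₂ + μ.2 • g₀)) 0 = s (μ, 0) := by
  rw [reduced_iteratedDeriv_two hDo hks hgrad hp]
  have hnhds : ∀ᶠ v in 𝓝 (0 : ℂ), ((μ, v) : (ℂ × ℂ) × ℂ) ∈ D := by
    have hc : Continuous fun v : ℂ => ((μ, v) : (ℂ × ℂ) × ℂ) := by fun_prop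
    exact hc.continuousAt.eventually_mem (hDo.mem_nhds hp)
  have hev : (fun v => eval (xs (μ, v)) (pderiv k (f₁ + μ.1 • g₂ + μ.2 • g₀))) =ᶠ[𝓝 0] fun v => v * s (μ, v) := by
    filter_upwards [hnhds] with v hv
    exact hks (μ, v) hv
  rw [hev.deriv_eq]
  have hsv : DifferentiableAt ℂ (fun v : ℂ => s (μ, v)) 0 := by
    have h1 : DifferentiableAt ℂ s (μ, 0) := hsd.differentiableAt (hDo.mem_nhds hp)
    exact h1.comp (0 : ℂ) ((differentiableAt_const μ).prodMk differentiableAt_id)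
  have h := (hasDerivAt_id' (0 : ℂ)).mul hsv.hasDerivAt
  show deriv ((fun v : ℂ => v) * fun v => s (μ, v)) 0 = _
  rw [h.deriv]
  simp

/-- **`∂ᵤ²r((α,0),0) ≠ 0` for `α ≠ 0` near `0`**: `s((α,0),0)` has a simple zero at `α = 0`, its derivative being
`∂ₖ∂ₖg₂(e_j) ≠ 0` (kernel-line jets: `d/dt s((ct,0),t)|₀ = c·∂ₖ∂ₖg₂(e_j)` for every `c`).
[cite: ArnoldGuseinzadeVarchenko2012, Part I §5.2] -/
theorem reduced_eventually_second_deriv_ne_zero (hf₁ : f₁.IsHomogeneous d) (hD : IsSymmetricA3Datum f₁ g₀ g₂ j k a)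
    (hDo : IsOpen D) (h0D : (0 : (ℂ × ℂ) × ℂ) ∈ D) (hxsA : AnalyticOnNhd ℂ xs D) (hsd : DifferentiableOn ℂ s D)
    (hxs0 : xs 0 = Pi.single j 1)
    (hchart : ∀ p ∈ D, xs p j = 1 ∧ xs p k = p.2 ∧
      ∀ i, i ≠ j → i ≠ k → eval (xs p) (pderiv i (f₁ + p.1.1 • g₂ + p.1.2 • g₀)) = 0)
    (hks : ∀ p ∈ D, eval (xs p) (pderiv k (f₁ + p.1.1 • g₂ + p.1.2 • g₀)) = p.2 * s p)
    (hgrad : ∀ p ∈ D, HasFDerivAt (fun q : (ℂ × ℂ) × ℂ => eval (xs q) (f₁ + q.1.1 • g₂ + q.1.2 • g₀))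
      (eval (xs p) g₂ • (ContinuousLinearMap.fst ℂ ℂ ℂ).comp (ContinuousLinearMap.fst ℂ (ℂ × ℂ) ℂ) +
        eval (xs p) g₀ • (ContinuousLinearMap.snd ℂ ℂ ℂ).comp (ContinuousLinearMap.fst ℂ (ℂ × ℂ) ℂ) +
        (p.2 * s p) • ContinuousLinearMap.snd ℂ (ℂ × ℂ) ℂ) p) :
    ∀ᶠ α in 𝓝[≠] (0 : ℂ), (((α, 0) : ℂ × ℂ), (0 : ℂ)) ∈ D ∧
      iteratedDeriv 2 (fun v => eval (xs ((α, 0), v)) (f₁ + ((α, 0) : ℂ × ℂ).1 • g₂ + ((α, 0) : ℂ × ℂ).2 • g₀)) 0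
        ≠ 0 := by
  -- the derivative of `s` at `0` along `((c,0),1)` is `c κ`
  set κ : ℂ := eval (Pi.single j (1 : ℂ)) (pderiv k (pderiv k g₂)) with hκ
  have hκne : κ ≠ 0 := hD.2.2.2.2.2.2.2.2.2.2.1
  have hs0 : DifferentiableAt ℂ s 0 := hsd.differentiableAt (hDo.mem_nhds h0D)
  have hline : ∀ c : ℂ, fderiv ℂ s 0 (((c, 0) : ℂ × ℂ), (1 : ℂ)) = c * κ := by
    intro c
    obtain ⟨hy, hy0, hyc, hlam⟩ := kernelLine_of_reducedChart hDo h0D hxsA hxs0 hchart hks c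
    have hσ : AnalyticAt ℂ (fun t : ℂ => s ((c * t, 0), t)) 0 := (analyticAt_comp_lines hDo h0D hsd c).1
    obtain ⟨-, hσ'⟩ := hD.kernelLine_reduced_jets hf₁ c hy hy0 hyc hσ hlam
    have hι : HasDerivAt (fun t : ℂ => (((c * t, 0), t) : (ℂ × ℂ) × ℂ)) (((c, 0) : ℂ × ℂ), (1 : ℂ)) 0 := by
      have h := (((hasDerivAt_id (0 : ℂ)).const_mul c).prodMk (hasDerivAt_const (0 : ℂ) (0 : ℂ))).prodMk
        (hasDerivAt_id (0 : ℂ))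
      simpa using h
    have hcomp : HasDerivAt (s ∘ fun t : ℂ => (((c * t, 0), t) : (ℂ × ℂ) × ℂ))
        (fderiv ℂ s 0 (((c, 0) : ℂ × ℂ), (1 : ℂ))) 0 :=
      hs0.hasFDerivAt.comp_hasDerivAt_of_eq (0 : ℂ) hι (lineC_zero c).symm
    rw [← hcomp.deriv]
    exact hσ'
  have hdα : fderiv ℂ s 0 (((1, 0) : ℂ × ℂ), (0 : ℂ)) = κ := by
    have h1 := hline 1
    have h0 := hline 0
    have hvec : ((((1 : ℂ), (0 : ℂ)), (0 : ℂ)) : (ℂ × ℂ) × ℂ) =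
        (((1, 0), 1) : (ℂ × ℂ) × ℂ) - (((0, 0), 1) : (ℂ × ℂ) × ℂ) := by
      ext <;> simp
    rw [hvec, map_sub, h1, h0]; ring
  -- `g(α) = s((α,0),0)`: analytic, `g'(0) = κ ≠ 0`, hence non-zero on a punctured neighbourhood
  have hga : AnalyticAt ℂ (fun α : ℂ => s ((α, 0), 0)) 0 := (analyticAt_comp_lines hDo h0D hsd 0).2.1
  have hg' : HasDerivAt (fun α : ℂ => s ((α, 0), 0)) κ 0 := by
    have hι : HasDerivAt (fun α : ℂ => (((α, 0), 0) : (ℂ × ℂ) × ℂ)) (((1, 0) : ℂ × ℂ), (0 : ℂ)) 0 := by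
      have h := (((hasDerivAt_id (0 : ℂ)).prodMk (hasDerivAt_const (0 : ℂ) (0 : ℂ))).prodMk
        (hasDerivAt_const (0 : ℂ) (0 : ℂ)))
      simpa using h
    have hcomp : HasDerivAt (s ∘ fun α : ℂ => (((α, 0), 0) : (ℂ × ℂ) × ℂ))
        (fderiv ℂ s 0 (((1, 0) : ℂ × ℂ), (0 : ℂ))) 0 :=
      hs0.hasFDerivAt.comp_hasDerivAt_of_eq (0 : ℂ) hι rfl
    rw [hdα] at hcomp
    exact hcomp
  have hgne : ∀ᶠ α in 𝓝[≠] (0 : ℂ), s ((α, 0), 0) ≠ 0 := by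
    rcases hga.eventually_eq_zero_or_eventually_ne_zero with h | h
    · exfalso
      have h' : (fun α : ℂ => s ((α, 0), 0)) =ᶠ[𝓝 0] fun _ => (0 : ℂ) := h
      have hd0 : deriv (fun α : ℂ => s ((α, 0), 0)) 0 = 0 := by
        rw [h'.deriv_eq, deriv_const]
      rw [hg'.deriv] at hd0
      exact hκne hd0
    · exact h
  have hmem : ∀ᶠ α in 𝓝[≠] (0 : ℂ), (((α, 0) : ℂ × ℂ), (0 : ℂ)) ∈ D := by
    have hc : Continuous fun α : ℂ => (((α, 0), 0) : (ℂ × ℂ) × ℂ) := by fun_prop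
    have h : ∀ᶠ α in 𝓝 (0 : ℂ), (((α, 0) : ℂ × ℂ), (0 : ℂ)) ∈ D :=
      hc.continuousAt.eventually_mem (hDo.mem_nhds h0D)
    exact nhdsWithin_le_nhds h
  filter_upwards [hmem, hgne] with α hαD hgα
  refine ⟨hαD, ?_⟩
  have h := reduced_iteratedDeriv_two_axis hDo hsd hks hgrad hαD
  rw [h]
  exact hgα

end IsSymmetricA3Datum

end HodgeTheory

end Literature.AlgebraicGeometry.HodgeTheory

end
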